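import Summits.Parity.GeneralizedHardyLittlewood.Theorems.PsiGradedTablesClosePoly.Negative.LinearPieceB
import Summits.Parity.GeneralizedHardyLittlewood.Theorems.PsiGradedTablesClosePoly.Negative.DarkCellsNoClosing
import HarnessLib

/-!
# Negative lane of `PsiGradedTablesClosePoly` (h2′): the threshold AT THE RATIFIED S4 DESIGN, by name —
# the equal LINEAR long sub-unit poly triple `(0.9 − x)³`

Y. Zhang, *Discrete mean estimates and the Landau–Siegel zero*, arXiv:2211.02515v1 [Zhang2022LandauSiegel] — an
unrefereed manuscript under adjudication; nothing here asserts any of its claims and nothing here is a statement about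
Landau–Siegel zeros. Desk lemmas of the §G referee (ls-ref-1; F1-THRESHOLD v1.1 §3 at the design the T0+36h roster order S4
names: «the WRAP term of x₂^{long} on the θ = 0.9 equal long sub-unit poly design»), composing `LinearPieceB`
(`41.98 < 𝔅(0.9 − x) < 42`) with `DarkCellsNoClosing` (Gershgorin rows; the `{0,2}` minor):

* `inClassPiece_linear`, `subUnitPolyToken_linear` — the linear piece of length `θ ≤ 1` is in-class, and for `θ < 1` carries
  the sub-unit poly class token `∃ θ' < 1, PolyShortPiece θ' · ·` (each leg of `SubUnitPolyPairs`);
* **`row_threshold_linear_nine_tenths`** — if the graded form is negative at ANY amplitudes on the triple `(0.9 − x)³`, some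
  row's off-diagonal cell mass exceeds `41.98` (so some long cell there has modulus `> 20.99`);
* **`gradedClosesOn_linear_nine_tenths_of_cell`** — if `𝒞` contains the pair `((0.9 − x), (0.9 − x))` and the NEW table there
  has `1764 ≤ ‖X₂‖²` (`= 42²`), then `GradedClosesOn 𝒞 X₁ Y₁ X₂` (one cell above the diagonal closes, whatever `X₁, Y₁`).

Between `41.98·(row)` and `42` (one cell) the 3×3 determinant at the displayed values decides (`DetClosesOn`); with three
displayed ratio constants use `ThreeConstantWrapThreshold`. No Theses statement asserted; no `def`; (A)-free; axioms standard.
-/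

noncomputable section

open Complex Real ComplexConjugate Polynomial

namespace Summit.Parity.GeneralizedHardyLittlewood.Theorems.PsiGradedTablesClosePoly.Negative

open Literature.NumberTheory.LFunctions.Zhang2022 Literature.NumberTheory.LFunctions.Zhang2022.KnifeEdge

/-! ### Part 1 — class membership of the linear piece -/

/-- The linear piece of length `θ ≤ 1` is an in-class piece. [cite: Zhang2022LandauSiegel, §7 (7.2) p.13] -/
theorem inClassPiece_linear {θ : ℝ} (hθ1 : θ ≤ 1) :
    InClassPiece (polyPiece θ (C (θ : ℂ) - X)) (polyPieceDeriv θ (C (θ : ℂ) - X)) :=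
  (polyShortPiece_linear hθ1).inClassPiece

/-- For `θ < 1` the linear piece carries the sub-unit poly class token `∃ θ' < 1, PolyShortPiece θ'` (a leg of the
h2′ line's `SubUnitPolyPairs`). [cite: Zhang2022LandauSiegel, §7 (7.2) p.13] -/
theorem subUnitPolyToken_linear {θ : ℝ} (hθ1 : θ < 1) :
    ∃ θ' : ℝ, θ' < 1 ∧ PolyShortPiece θ' (polyPiece θ (C (θ : ℂ) - X)) (polyPieceDeriv θ (C (θ : ℂ) - X)) :=
  ⟨θ, hθ1, polyShortPiece_linear hθ1.le⟩

/-! ### Part 2 — the threshold at `(0.9 − x)³`, by name -/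

/-- **Row threshold at the ratified S4 design `(0.9 − x)³` (proved):** if the graded form is negative at amplitudes `s` on the
equal linear triple, some row's off-diagonal mass exceeds `41.98` — so some long cell there has modulus `> 20.99`.
[cite: Zhang2022LandauSiegel, §2 (2.16)–(2.17), §7 Prop 7.1 (7.2)] -/
theorem row_threshold_linear_nine_tenths {X₁ Y₁ X₂ : PairFunctional} {s : Fin 3 → ℂ}
    (h : gradedQuadForm (gradedMainMatrix X₁ Y₁ X₂
      (polyPiece (9/10) (C ((9/10 : ℝ) : ℂ) - X)) (polyPieceDeriv (9/10) (C ((9/10 : ℝ) : ℂ) - X))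
      (polyPiece (9/10) (C ((9/10 : ℝ) : ℂ) - X)) (polyPieceDeriv (9/10) (C ((9/10 : ℝ) : ℂ) - X))
      (polyPiece (9/10) (C ((9/10 : ℝ) : ℂ) - X)) (polyPieceDeriv (9/10) (C ((9/10 : ℝ) : ℂ) - X))) s < 0) :
    let ℓ := polyPiece (9/10) (C ((9/10 : ℝ) : ℂ) - X); let ℓ' := polyPieceDeriv (9/10) (C ((9/10 : ℝ) : ℂ) - X)
    (41.98 : ℝ) < ‖X₁ ℓ ℓ' ℓ ℓ'‖ + ‖X₂ ℓ ℓ' ℓ ℓ'‖ ∨ (41.98 : ℝ) < ‖X₁ ℓ ℓ' ℓ ℓ'‖ + ‖Y₁ ℓ ℓ' ℓ ℓ'‖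
      ∨ (41.98 : ℝ) < ‖X₂ ℓ ℓ' ℓ ℓ'‖ + ‖Y₁ ℓ ℓ' ℓ ℓ'‖ := by
  intro ℓ ℓ'
  have hB := mainTermForm_linearPiece_nine_tenths.1
  have hG := gradedQuadForm_ge_rows X₁ Y₁ X₂ ℓ ℓ' ℓ ℓ' ℓ ℓ' s
  by_contra hcon
  push Not at hcon
  obtain ⟨h0, h1, h2⟩ := hcon
  nlinarith [mul_nonneg (by linarith : (0:ℝ) ≤ mainTermForm ℓ ℓ' - (‖X₁ ℓ ℓ' ℓ ℓ'‖ + ‖X₂ ℓ ℓ' ℓ ℓ'‖)) (sq_nonneg ‖s 0‖),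
    mul_nonneg (by linarith : (0:ℝ) ≤ mainTermForm ℓ ℓ' - (‖X₁ ℓ ℓ' ℓ ℓ'‖ + ‖Y₁ ℓ ℓ' ℓ ℓ'‖)) (sq_nonneg ‖s 1‖),
    mul_nonneg (by linarith : (0:ℝ) ≤ mainTermForm ℓ ℓ' - (‖X₂ ℓ ℓ' ℓ ℓ'‖ + ‖Y₁ ℓ ℓ' ℓ ℓ'‖)) (sq_nonneg ‖s 2‖)]

/-- **One-cell certificate at the ratified S4 design (proved):** if the class `𝒞` contains the pair `((0.9 − x), (0.9 − x))` and
the NEW table there has `1764 ≤ ‖X₂‖²` (`42² = 1764 > 𝔅·𝔅`), then `GradedClosesOn 𝒞 X₁ Y₁ X₂` — whatever `X₁, Y₁` are.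
[cite: Zhang2022LandauSiegel, §2 (2.16), §7 Prop 7.1 (7.2)] -/
theorem gradedClosesOn_linear_nine_tenths_of_cell {𝒞 : PairClass} {X₁ Y₁ X₂ : PairFunctional}
    (h𝒞 : 𝒞 (polyPiece (9/10) (C ((9/10 : ℝ) : ℂ) - X)) (polyPieceDeriv (9/10) (C ((9/10 : ℝ) : ℂ) - X))
      (polyPiece (9/10) (C ((9/10 : ℝ) : ℂ) - X)) (polyPieceDeriv (9/10) (C ((9/10 : ℝ) : ℂ) - X)))
    (hX : (1764 : ℝ) ≤ ‖X₂ (polyPiece (9/10) (C ((9/10 : ℝ) : ℂ) - X)) (polyPieceDeriv (9/10) (C ((9/10 : ℝ) : ℂ) - X))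
      (polyPiece (9/10) (C ((9/10 : ℝ) : ℂ) - X)) (polyPieceDeriv (9/10) (C ((9/10 : ℝ) : ℂ) - X))‖ ^ 2) :
    GradedClosesOn 𝒞 X₁ Y₁ X₂ := by
  have hℓ := inClassPiece_linear (θ := 9/10) (by norm_num)
  have hB := mainTermForm_linearPiece_nine_tenths
  refine gradedClosesOn_of_minor02 hℓ hℓ hℓ h𝒞 h𝒞 h𝒞 ?_
  have hBnn : (0:ℝ) ≤ mainTermForm (polyPiece (9/10) (C ((9/10 : ℝ) : ℂ) - X)) (polyPieceDeriv (9/10) (C ((9/10 : ℝ) : ℂ) - X)) := by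
    linarith [hB.1]
  nlinarith [hB.1, hB.2, mul_le_mul hB.2.le hB.2.le hBnn (by norm_num)]

end Summit.Parity.GeneralizedHardyLittlewood.Theorems.PsiGradedTablesClosePoly.Negative

end
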